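import Summits.Langlands.Langlands.Statement
import Summits.Langlands.Langlands.Theorems.BaseFieldAscentReciprocityTRCMGoodCMQuadratic
import Summits.Langlands.Langlands.Theorems.BaseFieldAscentReciprocityTRCMDeRhamRestrictOfLocal
import Summits.Langlands.Langlands.Theorems.BaseFieldAscentReciprocityTRCMStubDeRhamBaseChangeLocal
import Summits.Langlands.Langlands.Theorems.BaseFieldAscentReciprocityTRCMReciprocityCMtoTROfWeak
import Summits.Langlands.Langlands.Theorems.BaseFieldAscentReciprocityTRCMPotentialAutomorphyCMOfItem
import Literature.NumberTheory.Automorphic.GLnAdelicStructureProofs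
import HarnessLib

/-!
# Crux `ReciprocityTRCM` (stmt-Langlands-1093) from FOUR items: the trace-formula stubs leave the skeleton
# (line `pieces` = payload line `registered`, lead cycle 5; `--supports stmt-Langlands-1093` helper)

Support file (closes nothing).  Up to cycle 4 the registered skeleton closed the crux modulo SIX stubs:
items stmt-Langlands-1059 (`AutToGalCM`), 14091|CM (potential weak automorphy over CM fields), 1062
(`DescentOfAutomorphy`), 1063 (`AutToGalCMtoTR`), 18032 (`ArthurClozelCuspidalDescent`, Arthur–Clozel Ch. 3
Thm. 4.2 (d)) and the Literature named fact `ArthurClozel1989_strongLifting_archimedean` (Ch. 3 Thm. 5.1,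
archimedean clause).  The last two served ONE purpose: the weak direction (B) over a totally real `F` from
reciprocity over CM fields, by cyclic descent of the CM avatar `P ↔ ρ|_E` along a good CM quadratic `E/F` and
the L-algebraicity of the descended `π` (`weakGalToAutTR_of_reciprocityCM`, p172225).

Observation (this file): that step is ALREADY an instance of stub 3 = item stmt-Langlands-1062, which the
skeleton carries verbatim and which quantifies over EVERY number field `F` and every finite Galois `F'/F`:
"(A) for `𝓡` over `F` + `ρ` irreducible `𝓡`-geometric + weakly cuspidal-automorphic (L-algebraic) over some
finite Galois `F'/F` on which it stays irreducible ⇒ weakly cuspidal-automorphic (L-algebraic) over `F`".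
Over a totally real `F` take `F' := E`, the good CM quadratic of the landed
`stub_exists_goodCMQuadratic_of_deRhamRestriction` (p153974; `ρ|_E` irreducible and geometric for every datum
over `E`, the de Rham clause by the DISCHARGED Brinon–Conrad fact `DeRhamBaseChange_holds`, p169021/p169357,
through the plumbing `stub_deRham_restrictField_pinned_of_local`, p157558); reciprocity over the CM field `E`
((B) for its datum) supplies the L-algebraic cuspidal `P` over `E` corresponding to `ρ|_E`, in particular
Satake–Frobenius compatible almost everywhere; item 1062 at `(F, 𝓡, E, P)` returns the L-algebraic cuspidal
`π` over `F`.  No cyclic descent, no archimedean strong lifting, no twist matching: the quadratic (solvable)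
case of 1062 is where that content now lives (its own item stmt-Langlands-1064), and 1062 was a hypothesis of
the crux's reduction anyway (piece `X₂` over CM fields).

Consequences recorded here, hypotheses VERBATIM the ledger items (no route import, no `def`):
* `weakGalToAutTR_of_descentOfAutomorphy` — item 1062 → reciprocity over CM → weak (B) over totally real
  fields for every datum with (A) (the statement `weakGalToAutTR_of_reciprocityCM` concludes, minus its
  two trace-formula hypotheses);
* `reciprocityCMtoTR_of_descentOfAutomorphy_of_autToGalCMtoTR` — the shared support item stmt-Langlands-1096
  `ReciprocityCMtoTR` from items 1062 + 1063 only (weak-to-strong upgrade `corresponds_of_exists_corresponds`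
  inside the landed `reciprocityCMtoTR_of_autToGalCMtoTR_of_weak`, p172228);
* `reciprocityTRCM_of_four_stubs` — the crux from 1059, `stub_potentialAutomorphyCM`, 1062, 1063;
* `reciprocityTRCM_of_four_items` — the crux from items 1059, 14091, 1062, 1063 (seam p172229).
Standard axioms; no definitions.

## References
* P. Deligne, J.-P. Serre, *Formes modulaires de poids 1*, ASENS 7 (1974), Lemme 3.2. [DeligneSerreASENS1974]
* O. Brinon, B. Conrad, *CMI summer school notes on p-adic Hodge theory* (2009), Prop. 6.3.8. [BrinonConrad2009]
* T. Barnet-Lamb, T. Gee, D. Geraghty, R. Taylor, *Potential automorphy and change of weight*, Ann. of Math.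
  179 (2014), §5 (descent formalism). [BarnetlambEtAl2014]
* C. Sorensen, *A patching lemma* (2020), Thm. 1. [Sorensen2020]
-/

noncomputable section

set_option linter.dupNamespace false -- project-wide option (lakefile weak.linter.dupNamespace); `Summit.Langlands.Langlands` is the mandated namespace

open scoped MatrixGroups NumberField
open NumberField IsDedekindDomain Filter
open Literature.NumberTheory.Automorphic Literature.NumberTheory.GaloisRepresentations
open Summit.Langlands

namespace Summit.Langlands.Langlands.Theorems.ReciprocityTRCM

/-- **Weak (B) over totally real fields from reciprocity over CM fields and descent of weak automorphy**
(item stmt-Langlands-1062, verbatim): for `F` totally real, `𝓡` with (A) in all ranks and `ρ` irreducible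
`𝓡`-geometric, choose a CM quadratic `E/F` keeping `ρ` irreducible and geometric
(`stub_exists_goodCMQuadratic_of_deRhamRestriction`, de Rham restriction by `DeRhamBaseChange_holds`), take the
L-algebraic cuspidal `P ↔ ρ|_E` from (B) over `E`, and descend along `E/F` by item 1062.
[cite: BrinonConrad2009, Prop. 6.3.8] [cite: BarnetlambEtAl2014, §5] -/
theorem weakGalToAutTR_of_descentOfAutomorphy
    (h1062 : ∀ (F : Type) [Field F] [NumberField F] (R : ReciprocityData F), (∀ n : ℕ, 0 < n → ∀ hcpt : Literature.NumberTheory.Automorphic.isCompact_glFiniteIntegralLevel n F, AutomorphicToGalois n R hcpt) → ∀ (n : ℕ), 0 < n → ∀ (ℓ : ℕ) [Fact ℓ.Prime] (ι : PadicAlgCl ℓ ≃+* ℂ) (ρ : Literature.NumberTheory.GaloisRepresentations.FramedGaloisRep F (PadicAlgCl ℓ) n), ρ.toGaloisRep.IsIrreducible → IsGeometricFramed R ρ → (∃ (F' : Type) (_ : Field F') (_ : NumberField F') (_ : Algebra F F') (_ : IsGalois F F'), (ρ.restrictField F').toGaloisRep.IsIrreducible ∧ ∃ (hcpt' : Literature.NumberTheory.Automorphic.isCompact_glFiniteIntegralLevel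 n F') (π' : Literature.NumberTheory.Automorphic.CuspidalAutomorphicRepData n F' hcpt'), π'.1.IsLAlgebraic ∧ ∀ᶠ w : IsDedekindDomain.HeightOneSpectrum (NumberField.RingOfIntegers F') in cofinite, SatakeFrobCompatibleAt ι π'.1 (ρ.restrictField F') w) → ∀ hcpt : Literature.NumberTheory.Automorphic.isCompact_glFiniteIntegralLevel n F, ∃ π : Literature.NumberTheory.Automorphic.CuspidalAutomorphicRepData n F hcpt, π.1.IsLAlgebraic ∧ ∀ᶠ v : IsDedekindDomain.HeightOneSpectrum (NumberField.RingOfIntegers F) in cofinite, SatakeFrobCompatibleAt ι π.1 ρ v) :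
    (∀ (F : Type) [Field F] [NumberField F], NumberField.IsCMField F → ∃ R : ReciprocityData F, ∀ n : ℕ, 0 < n → ∀ hcpt : Literature.NumberTheory.Automorphic.isCompact_glFiniteIntegralLevel n F, GlobalLanglandsCorrespondenceGLn n F R hcpt) → ∀ (F : Type) [Field F] [NumberField F], NumberField.IsTotallyReal F → ∀ R : ReciprocityData F, (∀ n : ℕ, 0 < n → ∀ hcpt : Literature.NumberTheory.Automorphic.isCompact_glFiniteIntegralLevel n F, AutomorphicToGalois n R hcpt) → ∀ (n : ℕ), 0 < n → ∀ (ℓ : ℕ) [Fact ℓ.Prime] (ι : PadicAlgCl ℓ ≃+* ℂ) (ρ : Literature.NumberTheory.GaloisRepresentations.FramedGaloisRep F (PadicAlgCl ℓ) n), ρ.toGaloisRep.IsIrreducible → IsGeometricFramed R ρ → ∀ hcpt : Literature.NumberTheory.Automorphic.isCompact_glFiniteIntegralLevel n F, ∃ π : Literature.NumberTheory.Automorphic.CuspidalAutomorphicRepData n F hcpt, π.1.IsLAlgebraic ∧ ∀ᶠ v : IsDedekindDomain.HeightOneSpectrum (NumberField.RingOfIntegers F) in cofinite, SatakeFrobCompatibleAt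 ι π.1 ρ v := by
  -- de Rham-ness of the pinned data restricts along `E/F` (plumbing fed with the discharged local fact)
  have hdR := stub_deRham_restrictField_pinned_of_local stub_deRhamBaseChange_local
  have h5E := stub_exists_goodCMQuadratic_of_deRhamRestriction hdR
  intro hCM F _ _ hTR R hA n hn ℓ _ ι ρ hirr hgeo hcpt
  obtain ⟨E, iF, iN, iA, iG, -, hCME, hirrE, hgeoE⟩ := h5E F hTR R n hn ℓ ρ hirr hgeo
  obtain ⟨RE, hRE⟩ := hCM E hCME
  have hcptE : Literature.NumberTheory.Automorphic.isCompact_glFiniteIntegralLevel n E :=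
    Literature.NumberTheory.Automorphic.isCompact_glFiniteIntegralLevel_holds n E
  obtain ⟨P, hPL, hcorr⟩ := (hRE n hn hcptE).2 ℓ ι (ρ.restrictField E) hirrE (hgeoE RE)
  exact h1062 F R hA n hn ℓ ι ρ hirr hgeo ⟨E, iF, iN, iA, iG, hirrE, hcptE, P, hPL, hcorr.1⟩ hcpt

/-- **Item stmt-Langlands-1096 `ReciprocityCMtoTR` from items stmt-Langlands-1062 and stmt-Langlands-1063
only** (verbatim): (A) over totally real fields from 1063, weak (B) from `weakGalToAutTR_of_descentOfAutomorphy`,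
upgraded to (B) with local–global compatibility at every finite place inside
`reciprocityCMtoTR_of_autToGalCMtoTR_of_weak`. [cite: DeligneSerreASENS1974, Lemme 3.2] [cite: Sorensen2020, Thm. 1] -/
theorem reciprocityCMtoTR_of_descentOfAutomorphy_of_autToGalCMtoTR
    (h1062 : ∀ (F : Type) [Field F] [NumberField F] (R : ReciprocityData F), (∀ n : ℕ, 0 < n → ∀ hcpt : Literature.NumberTheory.Automorphic.isCompact_glFiniteIntegralLevel n F, AutomorphicToGalois n R hcpt) → ∀ (n : ℕ), 0 < n → ∀ (ℓ : ℕ) [Fact ℓ.Prime] (ι : PadicAlgCl ℓ ≃+* ℂ) (ρ : Literature.NumberTheory.GaloisRepresentations.FramedGaloisRep F (PadicAlgCl ℓ) n), ρ.toGaloisRep.IsIrreducible → IsGeometricFramed R ρ → (∃ (F' : Type) (_ : Field F') (_ : NumberField F') (_ : Algebra F F') (_ : IsGalois F F'), (ρ.restrictField F').toGaloisRep.IsIrreducible ∧ ∃ (hcpt' : Literature.NumberTheory.Automorphic.isCompact_glFiniteIntegralLevel n F') (π' : Literature.NumberTheory.Automorphic.CuspidalAutomorphicRepData n F' hcpt'),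 π'.1.IsLAlgebraic ∧ ∀ᶠ w : IsDedekindDomain.HeightOneSpectrum (NumberField.RingOfIntegers F') in cofinite, SatakeFrobCompatibleAt ι π'.1 (ρ.restrictField F') w) → ∀ hcpt : Literature.NumberTheory.Automorphic.isCompact_glFiniteIntegralLevel n F, ∃ π : Literature.NumberTheory.Automorphic.CuspidalAutomorphicRepData n F hcpt, π.1.IsLAlgebraic ∧ ∀ᶠ v : IsDedekindDomain.HeightOneSpectrum (NumberField.RingOfIntegers F) in cofinite, SatakeFrobCompatibleAt ι π.1 ρ v)
    (h1063 : (∀ (F : Type) [Field F] [NumberField F], NumberField.IsCMField F → ∃ R : ReciprocityData F, ∀ n : ℕ, 0 < n → ∀ hcpt : Literature.NumberTheory.Automorphic.isCompact_glFiniteIntegralLevel n F, AutomorphicToGalois n R hcpt) → ∀ (F : Type) [Field F] [NumberField F], NumberField.IsTotallyReal F → ∃ R : ReciprocityData F, ∀ n : ℕ, 0 < n → ∀ hcpt : Literature.NumberTheory.Automorphic.isCompact_glFiniteIntegralLevel n F, AutomorphicToGalois n R hcpt) :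
    (∀ (F : Type) [Field F] [NumberField F], NumberField.IsCMField F → ∃ R : ReciprocityData F, ∀ n : ℕ, 0 < n → ∀ hcpt : Literature.NumberTheory.Automorphic.isCompact_glFiniteIntegralLevel n F, GlobalLanglandsCorrespondenceGLn n F R hcpt) → ∀ (F : Type) [Field F] [NumberField F], NumberField.IsTotallyReal F → ∃ R : ReciprocityData F, ∀ n : ℕ, 0 < n → ∀ hcpt : Literature.NumberTheory.Automorphic.isCompact_glFiniteIntegralLevel n F, GlobalLanglandsCorrespondenceGLn n F R hcpt :=
  reciprocityCMtoTR_of_autToGalCMtoTR_of_weak h1063 (weakGalToAutTR_of_descentOfAutomorphy h1062)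

/-- **The crux statement (item stmt-Langlands-1093, verbatim) from FOUR stubs of line `pieces`**: 1059
(`X₁`), potential weak automorphy over CM fields and 1062 (`X₂`), 1062 again with 1063 (`X₃`); items 18032
and the archimedean clause of strong lifting are no longer hypotheses. [cite: DeligneSerreASENS1974, Lemme 3.2] -/
theorem reciprocityTRCM_of_four_stubs
    (h1059 : ∀ (F : Type) [Field F] [NumberField F], NumberField.IsCMField F → ∃ R : ReciprocityData F, ∀ n : ℕ, 0 < n → ∀ hcpt : Literature.NumberTheory.Automorphic.isCompact_glFiniteIntegralLevel n F, AutomorphicToGalois n R hcpt)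
    (hpot : ∀ (F : Type) [Field F] [NumberField F], NumberField.IsCMField F → ∀ R : ReciprocityData F, (∀ n : ℕ, 0 < n → ∀ hcpt : Literature.NumberTheory.Automorphic.isCompact_glFiniteIntegralLevel n F, AutomorphicToGalois n R hcpt) → ∀ (n : ℕ), 0 < n → ∀ (ℓ : ℕ) [Fact ℓ.Prime] (ι : PadicAlgCl ℓ ≃+* ℂ) (ρ : Literature.NumberTheory.GaloisRepresentations.FramedGaloisRep F (PadicAlgCl ℓ) n), ρ.toGaloisRep.IsIrreducible → IsGeometricFramed R ρ → ∃ (F' : Type) (_ : Field F') (_ : NumberField F') (_ : Algebra F F') (_ : IsGalois F F'), (ρ.restrictField F').toGaloisRep.IsIrreducible ∧ ∃ (hcpt' : Literature.NumberTheory.Automorphic.isCompact_glFiniteIntegralLevel n F') (π' : Literature.NumberTheory.Automorphic.CuspidalAutomorphicRepData n F' hcpt'), π'.1.IsLAlgebraic ∧ ∀ᶠ w : IsDedekindDomain.HeightOneSpectrum (NumberField.RingOfIntegers F') in cofinite, SatakeFrobCompatibleAt ι π'.1 (ρ.restrictField F') w)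
    (h1062 : ∀ (F : Type) [Field F] [NumberField F] (R : ReciprocityData F), (∀ n : ℕ, 0 < n → ∀ hcpt : Literature.NumberTheory.Automorphic.isCompact_glFiniteIntegralLevel n F, AutomorphicToGalois n R hcpt) → ∀ (n : ℕ), 0 < n → ∀ (ℓ : ℕ) [Fact ℓ.Prime] (ι : PadicAlgCl ℓ ≃+* ℂ) (ρ : Literature.NumberTheory.GaloisRepresentations.FramedGaloisRep F (PadicAlgCl ℓ) n), ρ.toGaloisRep.IsIrreducible → IsGeometricFramed R ρ → (∃ (F' : Type) (_ : Field F') (_ : NumberField F') (_ : Algebra F F') (_ : IsGalois F F'), (ρ.restrictField F').toGaloisRep.IsIrreducible ∧ ∃ (hcpt' : Literature.NumberTheory.Automorphic.isCompact_glFiniteIntegralLevel n F') (π' : Literature.NumberTheory.Automorphic.CuspidalAutomorphicRepData n F' hcpt'), π'.1.IsLAlgebraic ∧ ∀ᶠ w : IsDedekindDomain.HeightOneSpectrum (NumberField.RingOfIntegers F') in cofinite, SatakeFrobCompatibleAt ι π'.1 (ρ.restrictField F') w) → ∀ hcpt : Literature.NumberTheory.Automorphic.isCompact_glFiniteIntegralLevel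 n F, ∃ π : Literature.NumberTheory.Automorphic.CuspidalAutomorphicRepData n F hcpt, π.1.IsLAlgebraic ∧ ∀ᶠ v : IsDedekindDomain.HeightOneSpectrum (NumberField.RingOfIntegers F) in cofinite, SatakeFrobCompatibleAt ι π.1 ρ v)
    (h1063 : (∀ (F : Type) [Field F] [NumberField F], NumberField.IsCMField F → ∃ R : ReciprocityData F, ∀ n : ℕ, 0 < n → ∀ hcpt : Literature.NumberTheory.Automorphic.isCompact_glFiniteIntegralLevel n F, AutomorphicToGalois n R hcpt) → ∀ (F : Type) [Field F] [NumberField F], NumberField.IsTotallyReal F → ∃ R : ReciprocityData F, ∀ n : ℕ, 0 < n → ∀ hcpt : Literature.NumberTheory.Automorphic.isCompact_glFiniteIntegralLevel n F, AutomorphicToGalois n R hcpt) :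
    ∀ (F : Type) [Field F] [NumberField F], (NumberField.IsTotallyReal F ∨ NumberField.IsCMField F) → ∃ R : ReciprocityData F, ∀ n : ℕ, 0 < n → ∀ hcpt : Literature.NumberTheory.Automorphic.isCompact_glFiniteIntegralLevel n F, GlobalLanglandsCorrespondenceGLn n F R hcpt :=
  reciprocityTRCM_of_autToGalCM_of_weakGalToAutCM_of_reciprocityCMtoTR h1059
    (weakGalToAutCM_of_potentialAutomorphyCM_of_descent hpot h1062)
    (reciprocityCMtoTR_of_descentOfAutomorphy_of_autToGalCMtoTR h1062 h1063)

/-- **The crux statement (item stmt-Langlands-1093, verbatim) from FOUR existing ledger items only** —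
1059 `AutToGalCM`, 14091 `PotentialAutomorphy`, 1062 `DescentOfAutomorphy`, 1063 `AutToGalCMtoTR` — and
no Literature named fact. [cite: DeligneSerreASENS1974, Lemme 3.2] [cite: BarnetlambEtAl2014, Thm. 4.5.1] -/
theorem reciprocityTRCM_of_four_items
    (h1059 : ∀ (F : Type) [Field F] [NumberField F], NumberField.IsCMField F → ∃ R : ReciprocityData F, ∀ n : ℕ, 0 < n → ∀ hcpt : Literature.NumberTheory.Automorphic.isCompact_glFiniteIntegralLevel n F, AutomorphicToGalois n R hcpt)
    (h14091 : ∀ (F : Type) [Field F] [NumberField F], (∃ R₀ : ReciprocityData F, ∀ n : ℕ, 0 < n → ∀ hcpt : Literature.NumberTheory.Automorphic.isCompact_glFiniteIntegralLevel n F, AutomorphicToGalois n R₀ hcpt) → ∃ R : ReciprocityData F, (∀ n : ℕ, 0 < n → ∀ hcpt : Literature.NumberTheory.Automorphic.isCompact_glFiniteIntegralLevel n F, AutomorphicToGalois n R hcpt) ∧ ∀ (n : ℕ), 0 < n → ∀ (ℓ : ℕ) [Fact ℓ.Prime] (ι : PadicAlgCl ℓ ≃+* ℂ) (ρ : Literature.NumberTheory.GaloisRepresentations.FramedGaloisRep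 F (PadicAlgCl ℓ) n), ρ.toGaloisRep.IsIrreducible → IsGeometricFramed R ρ → ∃ (F' : Type) (_ : Field F') (_ : NumberField F') (_ : Algebra F F') (_ : IsGalois F F'), (ρ.restrictField F').toGaloisRep.IsIrreducible ∧ ∃ (hcpt' : Literature.NumberTheory.Automorphic.isCompact_glFiniteIntegralLevel n F') (π' : Literature.NumberTheory.Automorphic.CuspidalAutomorphicRepData n F' hcpt'), π'.1.IsLAlgebraic ∧ ∀ᶠ w : IsDedekindDomain.HeightOneSpectrum (NumberField.RingOfIntegers F') in cofinite, SatakeFrobCompatibleAt ι π'.1 (ρ.restrictField F') w)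
    (h1062 : ∀ (F : Type) [Field F] [NumberField F] (R : ReciprocityData F), (∀ n : ℕ, 0 < n → ∀ hcpt : Literature.NumberTheory.Automorphic.isCompact_glFiniteIntegralLevel n F, AutomorphicToGalois n R hcpt) → ∀ (n : ℕ), 0 < n → ∀ (ℓ : ℕ) [Fact ℓ.Prime] (ι : PadicAlgCl ℓ ≃+* ℂ) (ρ : Literature.NumberTheory.GaloisRepresentations.FramedGaloisRep F (PadicAlgCl ℓ) n), ρ.toGaloisRep.IsIrreducible → IsGeometricFramed R ρ → (∃ (F' : Type) (_ : Field F') (_ : NumberField F') (_ : Algebra F F') (_ : IsGalois F F'), (ρ.restrictField F').toGaloisRep.IsIrreducible ∧ ∃ (hcpt' : Literature.NumberTheory.Automorphic.isCompact_glFiniteIntegralLevel n F') (π' : Literature.NumberTheory.Automorphic.CuspidalAutomorphicRepData n F' hcpt'), π'.1.IsLAlgebraic ∧ ∀ᶠ w : IsDedekindDomain.HeightOneSpectrum (NumberField.RingOfIntegers F') in cofinite, SatakeFrobCompatibleAt ι π'.1 (ρ.restrictField F') w) → ∀ hcpt : Literature.NumberTheory.Automorphic.isCompact_glFiniteIntegralLevel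 n F, ∃ π : Literature.NumberTheory.Automorphic.CuspidalAutomorphicRepData n F hcpt, π.1.IsLAlgebraic ∧ ∀ᶠ v : IsDedekindDomain.HeightOneSpectrum (NumberField.RingOfIntegers F) in cofinite, SatakeFrobCompatibleAt ι π.1 ρ v)
    (h1063 : (∀ (F : Type) [Field F] [NumberField F], NumberField.IsCMField F → ∃ R : ReciprocityData F, ∀ n : ℕ, 0 < n → ∀ hcpt : Literature.NumberTheory.Automorphic.isCompact_glFiniteIntegralLevel n F, AutomorphicToGalois n R hcpt) → ∀ (F : Type) [Field F] [NumberField F], NumberField.IsTotallyReal F → ∃ R : ReciprocityData F, ∀ n : ℕ, 0 < n → ∀ hcpt : Literature.NumberTheory.Automorphic.isCompact_glFiniteIntegralLevel n F, AutomorphicToGalois n R hcpt) :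
    ∀ (F : Type) [Field F] [NumberField F], (NumberField.IsTotallyReal F ∨ NumberField.IsCMField F) → ∃ R : ReciprocityData F, ∀ n : ℕ, 0 < n → ∀ hcpt : Literature.NumberTheory.Automorphic.isCompact_glFiniteIntegralLevel n F, GlobalLanglandsCorrespondenceGLn n F R hcpt :=
  reciprocityTRCM_of_four_stubs h1059 (stub_potentialAutomorphyCM_of_potentialAutomorphy h14091) h1062 h1063

end Summit.Langlands.Langlands.Theorems.ReciprocityTRCM

end
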